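import Literature.Topology.FourManifolds.GluckTwistHomologyThree
import Literature.Topology.FourManifolds.HomotopyS4CriterionHurewicz
import Literature.Topology.FourManifolds.HomotopyS4SmoothCase
import Literature.AlgebraicTopology.Homotopy.WhiteheadContractibleProofs
import HarnessLib

/-!
# A Gluck twist is a homotopy 4-sphere (Gluck 1962, §17) — PROVED; the Gluck facts over Freedman alone

Sibling proof file of `GluckTwistHomotopySphere.lean` (fact seat
`provefact-Literature.Topology.FourManifolds.gluck_homeomorph_sphere_four`, D-0014/D-0026: no
definition, no new named fact, no `sorry`).  It DISCHARGES the named fact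
`Literature.Topology.FourManifolds.nonempty_homotopyEquiv_sphere_of_isGluckTwist`
(`GluckTwistHomotopySphere.lean`; H. Gluck, *The embedding of two-spheres in the four-sphere*,
Trans. AMS 104 (1962), §17: *the Gluck twist `Σ_K` of `S⁴` along any 2-knot `K` is a homotopy
4-sphere*; R. Kirby, *The topology of 4-manifolds*, LNM 1374 (1989), Ch. I §6, p. 14 of the held
scan: "The result `Q⁴(Θ)` is easily seen to be a homotopy 4-sphere") at every universe:

* `Literature.Topology.FourManifolds.nonempty_homotopyEquiv_sphere_of_isGluckTwist_holds`.

So far the tree had reduced this fact (`GluckTwistHomologyThree.lean`,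
`nonempty_homotopyEquiv_sphere_of_isGluckTwist_of_whitehead`) to Whitehead's theorem in homology
form (Hatcher Cor. 4.33, `whitehead_exists_homotopyEquiv`, still a named fact) and the CW homotopy
type of compact manifolds (Cor. A.12).  The present proof takes instead the *puncture* route of
`HomotopyS4CriterionHurewicz.lean` (Hatcher 2002, Example 0.10, Prop. 0.17, §2.2, Thm. 4.32;
Kosinski 1993, VI §2), every leaf of which is by now a THEOREM of the tree:

1. `Σ_K` is a closed simply connected 4-manifold with `H₂(Σ_K; ℤ) = H₃(Σ_K; ℤ) = 0`
   (`IsGluckTwist.compactSpace_holds`, `simplyConnectedSpace_of_isGluckTwist_holds`,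
   `isZero_singularHomologyZ_two_of_isGluckTwist_holds`, `isZero_singularHomology_three_of_isGluckTwist`
   — Gluck 1962, §17, all proved: Seifert–van Kampen and Mayer–Vietoris for
   `Σ_K = (S⁴ ∖ νK) ∪_τ (S² × D²)`), hence has the integral homology of `S⁴` (`H₁ = 0` by
   Hurewicz in degree one, `H_k = 0` for `k ≥ 5` by Hatcher Thm. 3.26(c), `H₄ ≠ 0` by the
   fundamental class, Thm. 3.26(a) — all proved in the tree);
2. hence `Σ_K ∖ {p}` is acyclic (Mayer–Vietoris/Bockstein,
   `isZero_singularHomology_compl_singleton_of_isZero`, proved) and simply connected (general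
   position, proved), so it is CONTRACTIBLE by the Whitehead–Hurewicz recognition principle for
   manifolds, which is DISCHARGED in the tree
   (`Literature.AlgebraicTopology.Homotopy.Manifold.contractibleSpace_of_simplyConnected_of_acyclic_holds`,
   `WhiteheadContractibleProofs.lean`: the Hurewicz theorem by Spanier's Eilenberg-subcomplex
   argument, and "weakly contractible manifolds are contractible" by a direct chart-by-chart
   construction — Bredon 1993, VII Cor. 10.11);
3. a Hausdorff space which is contractible after deleting a point with a Euclidean neighbourhood
   is homotopy equivalent to the sphere (`nonempty_homotopyEquiv_sphere_of_contractibleSpace_compl`,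
   `PuncturedContractible.lean`, proved; Hatcher Example 0.10 / Prop. 0.17).

## Contents (everything proved)

* §1 (closed simply connected topological 4-manifolds `M : Type` with `H₂ = H₃ = 0`, no Poincaré
  duality): `isZero_singularHomology_of_ne_of_isZero_two_three` (homology of `S⁴` off degrees
  `0, 4`), `contractibleSpace_compl_singleton_of_isZero_two_three` (`M ∖ {p}` is contractible),
  `nonempty_homotopyEquiv_sphere_four_of_isZero_two_three` (`M ≃ₕ S⁴`) — the hard direction of
  `spc4.S10` with its Poincaré-duality input replaced by the hypothesis `H₃ = 0`, unconditionally.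
* §2 (Gluck twists): `nonempty_homotopyEquiv_sphere_of_isGluckTwist_holds` (**Gluck 1962, §17,
  discharged**), the instance forms `IsGluckTwist.nonempty_homotopyEquiv_sphere` and
  `IsGluckTwist.contractibleSpace_compl_singleton` (`Σ_K ∖ {p}` is contractible — the input
  "`Σ⁴ - pt` is contractible so there is no obstruction to lifting the bundle" of Freedman's printed
  proof of Thm. 1.6, p. 371, for Gluck twists), at every universe.
* §3 (census of the homeomorphism facts): `gluck_compactSpace_holds` discharges the route fact
  `gluck_compactSpace` of `GluckTwistFacts.lean` (by `IsGluckTwist.compactSpace_holds`); with §2 the two named facts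
  `nonempty_homeomorph_sphere_of_isGluckTwist` (`GluckTwist.lean`) and `gluck_homeomorph_sphere_four`
  (`GluckTwistFacts.lean`: *a Gluck twist is homeomorphic to `S⁴`*) follow from FREEDMAN'S WORK
  ALONE, in either printed form: from Thm. 1.6 (`nonempty_homeomorph_sphere_four`, the topological
  4-dimensional Poincaré conjecture) — `nonempty_homeomorph_sphere_of_isGluckTwist_of_freedman16`,
  `gluck_homeomorph_sphere_four_of_freedman16`; or, `Σ_K` being smooth, from `Θ₄ = 0`
  (Kervaire–Milnor 1963, `isHCobordant_sphere_of_homotopySphere_four`) and the compact h-cobordism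
  theorem Thm. 1.3 (`nonempty_homeomorph_of_isHCobordant_four`) —
  `nonempty_homeomorph_sphere_of_isGluckTwist_of_thetaFour_freedman13`,
  `gluck_homeomorph_sphere_four_of_thetaFour_freedman13` (over the proved glue of
  `HomotopyS4SmoothCase.lean`).  Compare the third form over Cor. 1.2 for smooth `V`
  (`gluck_homeomorph_sphere_four_of_freedman1982_smooth`, `GluckTwistFreedmanSmooth.lean`).

After this file every statement of Gluck 1962, §17 used by the tree (compactness, `π₁ = 1`,
`H₂ = 0`, `H₃ = 0`, `Σ_K ≃ₕ S⁴`, `Σ_K ∖ pt` contractible) is a theorem, and the trust base of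
"`Σ_K ≅_TOP S⁴`" is exactly Freedman's theorem ({Thm. 1.6}, or {Cor. 1.2 for smooth `V`}, or
{`Θ₄ = 0`, Thm. 1.3}).  Whether `Σ_K ≅ S⁴` smoothly is open (Kirby Problem 4.24) and untouched.

## References

* H. Gluck, *The embedding of two-spheres in the four-sphere*, Trans. Amer. Math. Soc. 104 (1962)
  308–333, §17. [GluckTAMS1962]
* R. C. Kirby, *The Topology of 4-Manifolds*, Lecture Notes in Math. 1374 (1989), Ch. I §6
  (p. 14 of the held scan). [Kirby1989]
* A. Hatcher, *Algebraic Topology*, CUP 2002: Example 0.10, Prop. 0.17, §2.2, Thm. 2A.1,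
  Thm. 3.26, Thm. 4.32. [HatcherAT2002]
* A. Kosinski, *Differential Manifolds*, Academic Press (1993), Ch. VI §2. [Kosinski1993]
* G. E. Bredon, *Topology and Geometry*, GTM 139 (1993), Ch. VII, Cor. 10.11. [Bredon1993]
* M. H. Freedman, *The topology of four-dimensional manifolds*, J. Differential Geom. 17 (1982)
  357–453, Thm. 1.3 (p. 363), Thm. 1.6 (p. 371). [FreedmanJDG1982]
* M. Kervaire, J. Milnor, *Groups of homotopy spheres I*, Ann. of Math. 77 (1963) 504–537
  (`Θ₄ = 0`, table p. 504). [KervaireMilnorAnnals1963]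
-/

noncomputable section

open CategoryTheory Limits ContinuousMap Set
open scoped Manifold ContDiff Topology

namespace Literature.Topology.FourManifolds

/-! ### §1 Closed simply connected 4-manifolds with `H₂ = H₃ = 0` (no Poincaré duality) -/

section SPC4

variable {M : Type} [TopologicalSpace M] [T2Space M] [CompactSpace M]
  [ChartedSpace (EuclideanSpace ℝ (Fin 4)) M] [SimplyConnectedSpace M]

/-- **A closed simply connected 4-manifold with `H₂ = H₃ = 0` has the integral homology of `S⁴`
off the top degree**: `Hₖ(M; ℤ) = 0` for `k ≠ 0, 4` — `H₁ = 0` by Hurewicz in degree one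
(Hatcher Thm. 2A.1, proved), `H₂ = H₃ = 0` by hypothesis, `Hₖ = 0` for `k ≥ 5` (Thm. 3.26(c),
proved).  This is `isZero_singularHomology_of_ne_of_poincareDuality` with its single use of
Poincaré duality (`H₃ ≅ H¹ = 0`) replaced by the hypothesis `H₃ = 0`.
[cite: HatcherAT2002, Thm. 2A.1 and Thm. 3.26] -/
theorem isZero_singularHomology_of_ne_of_isZero_two_three
    (hH₂ : IsZero (Literature.AlgebraicTopology.SingularHomology.singularHomology ℤ ℤ M 2))
    (hH₃ : IsZero (Literature.AlgebraicTopology.SingularHomology.singularHomology ℤ ℤ M 3))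
    {k : ℕ} (hk0 : k ≠ 0) (hk4 : k ≠ 4) :
    IsZero (Literature.AlgebraicTopology.SingularHomology.singularHomology ℤ ℤ M k) := by
  have h1 : IsZero (Literature.AlgebraicTopology.SingularHomology.singularHomology ℤ ℤ M 1) :=
    Literature.AlgebraicTopology.SingularHomology.isZero_singularHomology_one_of_simplyConnectedSpace ℤ ℤ
  have hk1 : 1 ≤ k := Nat.pos_of_ne_zero hk0
  rcases Nat.lt_or_gt_of_ne hk4 with hk | hk
  · interval_cases k
    · exact h1
    · exact hH₂
    · exact hH₃
  · exact Literature.AlgebraicTopology.SingularHomology.isZero_singularHomology_of_lt_holds ℤ ℤ M 4 hk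

/-- **A punctured closed simply connected 4-manifold with `H₂ = H₃ = 0` is acyclic**:
`Hₖ(M ∖ {p}; ℤ) = 0` for `k ≥ 1` (Mayer–Vietoris for `M = (M ∖ p) ∪ B` with a chart ball `B`,
and the Bockstein argument in degree `3`: `isZero_singularHomology_compl_singleton_of_isZero`,
proved in `HomotopyS4CriterionHurewicz.lean`; Kosinski 1993, VI §2), the inputs "`M` has the
homology of `S⁴`" being `isZero_singularHomology_of_ne_of_isZero_two_three` and the fundamental
class `H₄(M; ℤ) ≠ 0` (`not_isZero_singularHomology_four`, Hatcher Thm. 3.26(a), over the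
`ℤ`-orientation of a simply connected manifold, Prop. 3.25 — both proved).
[cite: Kosinski1993, Ch. VI §2] [cite: HatcherAT2002, §2.2 p. 149, Prop. 3.25 and Thm. 3.26] -/
theorem isZero_singularHomology_compl_singleton_of_isZero_two_three
    (hH₂ : IsZero (Literature.AlgebraicTopology.SingularHomology.singularHomology ℤ ℤ M 2))
    (hH₃ : IsZero (Literature.AlgebraicTopology.SingularHomology.singularHomology ℤ ℤ M 3))
    (p : M) {k : ℕ} (hk : 1 ≤ k) :
    IsZero (Literature.AlgebraicTopology.SingularHomology.singularHomology ℤ ℤ ↥(({p}ᶜ : Set M)) k) := by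
  obtain ⟨μ⟩ : Literature.AlgebraicTopology.SingularHomology.IsOrientableOver ℤ M 4 :=
    Literature.AlgebraicTopology.SingularHomology.isOrientableOver_int_of_simplyConnectedSpace_holds M
  have hM : ∀ j : ℕ, j ≠ 0 → j ≠ 3 + 1 →
      IsZero (Literature.AlgebraicTopology.SingularHomology.singularHomology ℤ ℤ M j) :=
    fun j hj0 hj4 => isZero_singularHomology_of_ne_of_isZero_two_three hH₂ hH₃ hj0 hj4
  have hMtop : ¬ IsZero (Literature.AlgebraicTopology.SingularHomology.singularHomology ℤ ℤ M (3 + 1)) :=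
    not_isZero_singularHomology_four μ
  exact isZero_singularHomology_compl_singleton_of_isZero (m := 3) (by norm_num) hM hMtop p hk

/-- **A punctured closed simply connected 4-manifold with `H₂ = H₃ = 0` is contractible**,
unconditionally.  `M ∖ {p}` is an open, hence Hausdorff second-countable, topological
4-manifold, simply connected (general position:
`isSimplyConnected_compl_singleton_of_isOpenEmbedding`, proved) and acyclic
(`isZero_singularHomology_compl_singleton_of_isZero_two_three`), so it is contractible by the
Whitehead–Hurewicz recognition principle for manifolds, DISCHARGED in the tree
(`Manifold.contractibleSpace_of_simplyConnected_of_acyclic_holds`: Bredon 1993, VII Cor. 10.11 —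
Hurewicz, Hatcher Thm. 4.32, and "weakly contractible manifolds are contractible").  Compare
`contractibleSpace_compl_singleton_of_hurewicz` (same file family), which assumed Poincaré
duality, Hurewicz and Milnor's CW type as hypotheses.
[cite: Bredon1993, Ch. VII Cor. 10.11] [cite: HatcherAT2002, Thm. 4.32] [cite: Kosinski1993, Ch. VI §2] -/
theorem contractibleSpace_compl_singleton_of_isZero_two_three [SecondCountableTopology M]
    (hH₂ : IsZero (Literature.AlgebraicTopology.SingularHomology.singularHomology ℤ ℤ M 2))
    (hH₃ : IsZero (Literature.AlgebraicTopology.SingularHomology.singularHomology ℤ ℤ M 3))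
    (p : M) : ContractibleSpace ↥(({p}ᶜ : Set M)) := by
  -- `M ∖ {p}` is acyclic
  have hac : ∀ k : ℕ, 1 ≤ k →
      IsZero (Literature.AlgebraicTopology.SingularHomology.singularHomology ℤ ℤ ↥(({p}ᶜ : Set M)) k) :=
    fun k hk => isZero_singularHomology_compl_singleton_of_isZero_two_three hH₂ hH₃ p hk
  -- `M ∖ {p}` is simply connected (general position in dimension `4 ≥ 3`)
  obtain ⟨i, hi, hi0⟩ :=
    Literature.AlgebraicTopology.Homotopy.exists_isOpenEmbedding_apply_zero_eq (E := EuclideanSpace ℝ (Fin 4)) p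
  haveI : SimplyConnectedSpace ↥(({p}ᶜ : Set M)) := by
    rw [← hi0]
    exact Literature.AlgebraicTopology.FundamentalGroupoid.isSimplyConnected_compl_singleton_of_isOpenEmbedding
      hi (by simp)
  -- Whitehead–Hurewicz for the open submanifold `M ∖ {p}` (discharged recognition principle)
  exact Literature.AlgebraicTopology.Homotopy.Manifold.contractibleSpace_of_simplyConnected_of_acyclic.of_isOpen
    Literature.AlgebraicTopology.Homotopy.Manifold.contractibleSpace_of_simplyConnected_of_acyclic_holds
    4 isOpen_compl_singleton hac

/-- **A closed simply connected 4-manifold with `H₂ = H₃ = 0` is homotopy equivalent to `S⁴`**,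
unconditionally (the hard direction of `spc4.S10`, Freedman–Quinn 1990, §10.1, with its
Poincaré-duality input `H₃ ≅ H¹ = 0` replaced by the hypothesis `H₃ = 0`): `M ∖ {p}` is
contractible (`contractibleSpace_compl_singleton_of_isZero_two_three`), and a Hausdorff space which
is contractible after deleting a point with a Euclidean neighbourhood is homotopy equivalent to the
sphere (`nonempty_homotopyEquiv_sphere_of_contractibleSpace_compl`, proved: `M ≃ (M ∖ p)⁺ ≃ (ℝ⁴)⁺ ≅ S⁴`,
Hatcher Example 0.10 and Prop. 0.17).  Compare `nonempty_homotopyEquiv_sphere_four_of_isZero`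
(`GluckTwistHomologyThree.lean`, GIVEN Whitehead's theorem Cor. 4.33 and the CW type Cor. A.12) and
`nonempty_homotopyEquiv_sphere_four_of_hurewicz` (GIVEN Poincaré duality, Hurewicz, Milnor's CW
type). [cite: FreedmanQuinnPMS1990, §10.1] [cite: HatcherAT2002, Example 0.10, Prop. 0.17 and Thm. 4.32] -/
theorem nonempty_homotopyEquiv_sphere_four_of_isZero_two_three [SecondCountableTopology M]
    (hH₂ : IsZero (Literature.AlgebraicTopology.SingularHomology.singularHomology ℤ ℤ M 2))
    (hH₃ : IsZero (Literature.AlgebraicTopology.SingularHomology.singularHomology ℤ ℤ M 3)) :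
    Nonempty (M ≃ₕ Metric.sphere (0 : EuclideanSpace ℝ (Fin 5)) 1) := by
  obtain ⟨p⟩ : Nonempty M := inferInstance
  obtain ⟨i, hi, hi0⟩ :=
    Literature.AlgebraicTopology.Homotopy.exists_isOpenEmbedding_apply_zero_eq (E := EuclideanSpace ℝ (Fin 4)) p
  have hc : ContractibleSpace ↥(({i 0}ᶜ : Set M)) :=
    contractibleSpace_compl_singleton_of_isZero_two_three hH₂ hH₃ (i 0)
  exact Literature.AlgebraicTopology.Homotopy.nonempty_homotopyEquiv_sphere_of_contractibleSpace_compl hi hc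

end SPC4

/-! ### §2 Gluck 1962, §17: `Σ_K ≃ₕ S⁴`, discharged -/

section Gluck

universe u

variable {K : TwoKnot}

/-- **Gluck 1962, §17 at universe `0`, proved**: a Gluck twist `X : Type` of `S⁴` along `K` is
compact, simply connected, with `H₂(X; ℤ) = H₃(X; ℤ) = 0` (all proved in the tree), hence
`≃ₕ S⁴` by `nonempty_homotopyEquiv_sphere_four_of_isZero_two_three`.
[cite: GluckTAMS1962, §17] [cite: Kirby1989, Ch. I §6 (p. 14 of the scan)] -/
theorem nonempty_homotopyEquiv_sphere_of_isGluckTwist_univ_zero_holds :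
    nonempty_homotopyEquiv_sphere_of_isGluckTwist.{0} (K := K) := by
  intro X _ _ _ _ _ h
  haveI : CompactSpace X := IsGluckTwist.compactSpace_holds h
  haveI : SimplyConnectedSpace X := simplyConnectedSpace_of_isGluckTwist_holds h
  exact nonempty_homotopyEquiv_sphere_four_of_isZero_two_three
    (isZero_singularHomologyZ_two_of_isGluckTwist_holds h)
    (isZero_singularHomology_three_of_isGluckTwist ℤ ℤ h)

/-- **Gluck 1962, §17 — the named fact `nonempty_homotopyEquiv_sphere_of_isGluckTwist`
DISCHARGED at every universe: every Gluck twist `Σ_K` of `S⁴` along a 2-knot `K` (a Hausdorff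
second countable smooth 4-manifold `X : Type u` with `IsGluckTwist (𝓡 4) X K`) is homotopy
equivalent to `S⁴`.**  Printed argument (Gluck, Trans. AMS 104 (1962), §17; Kirby 1989, Ch. I §6:
"The result `Q⁴(Θ)` is easily seen to be a homotopy 4-sphere"): `Σ_K = (S⁴ ∖ νK) ∪_τ (S² × D²)`
is simply connected (the meridian normally generates `π₁(S⁴ ∖ K)` and still bounds after the
regluing) and has the homology of `S⁴` (Mayer–Vietoris: `τ` acts trivially on `H_*(S² × S¹)`),
and a simply connected homology 4-sphere is a homotopy 4-sphere (Hurewicz–Whitehead).  Formal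
route: the universe-`0` case `nonempty_homotopyEquiv_sphere_of_isGluckTwist_univ_zero_holds`
(puncture, Hurewicz, contractibility of weakly contractible manifolds — all proved) lifted along
`Shrink` by `nonempty_homotopyEquiv_sphere_of_isGluckTwist_of_univ_zero`.
[cite: GluckTAMS1962, §17] [cite: Kirby1989, Ch. I §6 (p. 14 of the scan)] -/
theorem nonempty_homotopyEquiv_sphere_of_isGluckTwist_holds :
    nonempty_homotopyEquiv_sphere_of_isGluckTwist.{u} (K := K) :=
  nonempty_homotopyEquiv_sphere_of_isGluckTwist_of_univ_zero
    nonempty_homotopyEquiv_sphere_of_isGluckTwist_univ_zero_holds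

omit K in
/-- **A Gluck twist is a homotopy 4-sphere** (instance form of
`nonempty_homotopyEquiv_sphere_of_isGluckTwist_holds`; Gluck 1962, §17). [cite: GluckTAMS1962, §17] -/
theorem IsGluckTwist.nonempty_homotopyEquiv_sphere {K : TwoKnot} {X : Type u} [TopologicalSpace X]
    [T2Space X] [SecondCountableTopology X] [ChartedSpace (EuclideanSpace ℝ (Fin 4)) X]
    [IsManifold (𝓡 4) ∞ X] (h : IsGluckTwist (𝓡 4) X K) :
    Nonempty (X ≃ₕ Metric.sphere (0 : EuclideanSpace ℝ (Fin 5)) 1) :=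
  nonempty_homotopyEquiv_sphere_of_isGluckTwist_holds h

omit K in
/-- **A punctured Gluck twist is contractible**: for every Gluck twist `X : Type u` and `p ∈ X`,
`X ∖ {p}` is contractible (Gluck 1962, §17 with Hurewicz–Whitehead; this is the input "`Σ⁴ - pt`
is contractible" of Freedman's printed proof of Thm. 1.6, J. Differential Geom. 17 (1982), p. 371,
for `Σ = Σ_K`).  Universe `0`: `contractibleSpace_compl_singleton_of_isZero_two_three`; in
general transport along `φ : X ≃ₜ Shrink.{0} X`, which carries `X ∖ {p}` onto
`Shrink X ∖ {φ p}` and the Gluck-twist structure onto `Shrink X` (`IsGluckTwist.of_diffeomorph`).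
[cite: GluckTAMS1962, §17] [cite: FreedmanJDG1982, proof of Thm. 1.6 p. 371] -/
theorem IsGluckTwist.contractibleSpace_compl_singleton {K : TwoKnot} {X : Type u}
    [TopologicalSpace X] [T2Space X] [SecondCountableTopology X]
    [ChartedSpace (EuclideanSpace ℝ (Fin 4)) X] [IsManifold (𝓡 4) ∞ X]
    (hX : IsGluckTwist (𝓡 4) X K) (p : X) : ContractibleSpace ↥(({p}ᶜ : Set X)) := by
  haveI : Small.{0} X := hX.small
  let φ : X ≃ₜ Shrink.{0} X := Shrink.homeomorph X
  letI : ChartedSpace (EuclideanSpace ℝ (Fin 4)) (Shrink.{0} X) :=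
    Homeomorph.transportChartedSpace φ
  haveI : IsManifold (𝓡 4) ∞ (Shrink.{0} X) :=
    Homeomorph.isManifold_transportChartedSpace (I₀ := 𝓡 4) (n := ∞) φ
  haveI : T2Space (Shrink.{0} X) := φ.t2Space
  haveI : SecondCountableTopology (Shrink.{0} X) := φ.symm.secondCountableTopology
  have h' : IsGluckTwist (𝓡 4) (Shrink.{0} X) K :=
    hX.of_diffeomorph (Homeomorph.transportDiffeomorph (I₀ := 𝓡 4) (n := ∞) φ)
  haveI : CompactSpace (Shrink.{0} X) := IsGluckTwist.compactSpace_holds h'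
  haveI : SimplyConnectedSpace (Shrink.{0} X) := simplyConnectedSpace_of_isGluckTwist_holds h'
  have hc : ContractibleSpace ↥(({φ p}ᶜ : Set (Shrink.{0} X))) :=
    contractibleSpace_compl_singleton_of_isZero_two_three
      (isZero_singularHomologyZ_two_of_isGluckTwist_holds h')
      (isZero_singularHomology_three_of_isGluckTwist ℤ ℤ h') (φ p)
  -- `X ∖ {p} ≃ₜ Shrink X ∖ {φ p}`
  let e : ↥(({p}ᶜ : Set X)) ≃ₜ ↥(({φ p}ᶜ : Set (Shrink.{0} X))) :=
    φ.subtype (p := fun x : X => x ∈ (({p}ᶜ : Set X)))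
      (q := fun y : Shrink.{0} X => y ∈ (({φ p}ᶜ : Set (Shrink.{0} X)))) fun x => by
        simp only [mem_compl_iff, mem_singleton_iff, φ.injective.eq_iff]
  exact e.contractibleSpace

end Gluck

/-! ### §3 Census: the homeomorphism facts over Freedman's theorem alone -/

section Census

universe u

/-- **The route fact `gluck_compactSpace` (`GluckTwistFacts.lean`), discharged**: a Gluck twist
is compact (Gluck 1962, §17: the union of the images of the compact pieces `S⁴ ∖ ν(S² × B₁)` and
`S² × B̄₁`) — the instance `IsGluckTwist.compactSpace_holds` of `GluckTwistProofs.lean` at the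
model `𝓡 4` and carriers `X : Type`. [cite: GluckTAMS1962, §17] -/
theorem gluck_compactSpace_holds : gluck_compactSpace :=
  fun _ _ _ _ _ _ _ hX => IsGluckTwist.compactSpace_holds hX

variable {K : TwoKnot}

/-- **`Σ_K ≃ₜ S⁴` from Freedman's Thm. 1.6 alone** (Gluck 1962, §17 being proved): the named
fact `nonempty_homeomorph_sphere_of_isGluckTwist` (`GluckTwist.lean`) follows from the topological
4-dimensional Poincaré conjecture `nonempty_homeomorph_sphere_four` (Freedman 1982, Thm. 1.6;
Freedman–Quinn 1990, Cor. 7.1B) at the same universe.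
[cite: GluckTAMS1962, §17] [cite: FreedmanJDG1982, Thm. 1.6] -/
theorem nonempty_homeomorph_sphere_of_isGluckTwist_of_freedman16
    (hF : FourManifolds.nonempty_homeomorph_sphere_four.{u}) :
    nonempty_homeomorph_sphere_of_isGluckTwist.{u} (K := K) :=
  nonempty_homeomorph_sphere_of_isGluckTwist_of nonempty_homotopyEquiv_sphere_of_isGluckTwist_holds hF

omit K in
/-- **The route fact `gluck_homeomorph_sphere_four` from Freedman's Thm. 1.6 alone**
(`GluckTwistFacts.lean`: a Gluck twist is homeomorphic to `S⁴`; Gluck 1962 §17 + Freedman 1982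
Thm. 1.6), the Gluck half being proved. [cite: GluckTAMS1962, §17] [cite: FreedmanJDG1982, Thm. 1.6] -/
theorem gluck_homeomorph_sphere_four_of_freedman16
    (hF : FourManifolds.nonempty_homeomorph_sphere_four.{0}) : gluck_homeomorph_sphere_four :=
  gluck_homeomorph_sphere_four_of_facts (fun _ => nonempty_homotopyEquiv_sphere_of_isGluckTwist_holds) hF

/-- **`Σ_K ≃ₜ S⁴` from `Θ₄ = 0` and the compact h-cobordism theorem** (the smooth route of
`HomotopyS4SmoothCase.lean`, Gluck 1962 §17 being proved): GIVEN that every smooth homotopy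
4-sphere is smoothly h-cobordant to `S⁴` (`isHCobordant_sphere_of_homotopySphere_four`,
Kervaire–Milnor 1963, `Θ₄ = 0`; Wall 1964) and Freedman's Thm. 1.3 (simply connected closed
smooth h-cobordant 4-manifolds are homeomorphic, `nonempty_homeomorph_of_isHCobordant_four.{0}`),
every Gluck twist — a closed smooth homotopy 4-sphere — is homeomorphic to `S⁴`
(`nonempty_homeomorph_sphere_of_isGluckTwist_of_thetaFour` fed with
`nonempty_homotopyEquiv_sphere_of_isGluckTwist_holds`).
[cite: GluckTAMS1962, §17] [cite: FreedmanJDG1982, Thm. 1.3 p. 363] [cite: KervaireMilnorAnnals1963, table p. 504 (Θ₄ = 0)] -/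
theorem nonempty_homeomorph_sphere_of_isGluckTwist_of_thetaFour_freedman13
    (hΘ : isHCobordant_sphere_of_homotopySphere_four)
    (h13 : nonempty_homeomorph_of_isHCobordant_four.{0}) :
    nonempty_homeomorph_sphere_of_isGluckTwist.{u} (K := K) :=
  nonempty_homeomorph_sphere_of_isGluckTwist_of_thetaFour
    nonempty_homotopyEquiv_sphere_of_isGluckTwist_holds hΘ h13

omit K in
/-- **The route fact `gluck_homeomorph_sphere_four` from `Θ₄ = 0` and Freedman's Thm. 1.3 alone**
(compare `gluck_homeomorph_sphere_four_of_spc4_thetaFour`, which needed `spc4.S10` besides, and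
`gluck_homeomorph_sphere_four_of_freedman1982_smooth` over Cor. 1.2 for smooth `V`).
[cite: GluckTAMS1962, §17] [cite: FreedmanJDG1982, Thm. 1.3 p. 363] [cite: KervaireMilnorAnnals1963, table p. 504 (Θ₄ = 0)] -/
theorem gluck_homeomorph_sphere_four_of_thetaFour_freedman13
    (hΘ : isHCobordant_sphere_of_homotopySphere_four)
    (h13 : nonempty_homeomorph_of_isHCobordant_four.{0}) : gluck_homeomorph_sphere_four :=
  gluck_homeomorph_sphere_four_of fun _ =>
    nonempty_homeomorph_sphere_of_isGluckTwist_of_thetaFour_freedman13 hΘ h13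

end Census

end Literature.Topology.FourManifolds

end
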